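import Summits.QuantumFields.BalabanUV.Gaps.EndDrawdownLinearRecovering
import Summits.QuantumFields.BalabanUV.Gaps.EndDrawdownLinearCeiling

/-!
# Gaps / EndDrawdownLinearPartialRecovery — RECOVERY MUST BE COMPLETE: the staircase with PARTIAL recovery `θ·(15·16^t − 1)κ∕2^t` at the end of
# each block (`bPart κ θ`; `θ = 1` is the recovering staircase `EndDrawdownLinearRecovering.bRec`, `θ = 0` the staircase with a silent last step) is
# possible on the linear road **iff `θ ≥ 1`** — for EVERY `C > 0` and every box (`endPossibleLin_bPart_iff`).  `θ ≥ 1`: `bPart ≥ bRec` pointwise and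
# possibility is monotone in the one-loop part (`EndDrawdownLinearCeiling.endPossibleLin_mono_seq`).  `θ < 1`: a CEILING–CHAIN WITH JOINTS — the
# parametrised ceiling `EndDrawdownLinearCeiling.backOrbit_ceiling_lin_m` (above the level `m²(C∕ε)²` the help is `≤ ε∕m`, so rate steps descend at
# `(1 − 1∕m)ε` read backward), one JOINT step of arbitrary sign per block paid at face value plus `Cγ` (`backOrbit_joint_le`), and the chain
# `backOrbit_below_clamp_of_jointStaircase` ∕ `not_endPossibleLin_of_jointStaircase`; for `bPart` with `m = 2∕(1−θ)` each block still descends by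
# `((1−θ)∕2)·(15·16^t − 1)κ∕2^t ≍ 8^t` against ceiling gaps `≍ 4^t` (`not_endPossibleLin_bPart`).  So the unrecovered remainder `(1−θ)·depth` of
# each block, unbounded in `t`, is exactly what kills possibility: on the linear road the END statement's possibility reads whether drawdown is
# recovered UP TO A BOUNDED BUDGET (`EndDrawdownLinearFloorEntry.endPossibleLin_of_recovering`), for every `C` alike (cell pub-balaban-gaps, seat
# g1-p3 GEN 10, rows CAP ∕ tail ∕ (D4) «split ∕ weakening»; this seat's own leaf; file 23 of «the one-loop interface of the END statement»)

HONEST FRAMING (cell rule, page 1 of everything): [folklore] window arithmetic along backward orbits of the tree's clamped step map for ONE explicit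
toy family; `EndPossibleLin` is a quantified READING of the cell's END-grade statement over Bałaban-free data `(b, C, γ₀)`, not a binder; the
(AF-1) linear road is a located UNPRINTED hypothesis shape ([I] (2.12)–(2.14) ∕ [II] p. 8 after (1.29); `CapSignsConstRoad` §1); NOTHING of
Bałaban's table is certified (NODE-O 0∕1, CAP coefficients 0); words ∕ odds of rows CAP ∕ tail ∕ (D4) ∕ (D1) UNCHANGED; 0∕6 binders; one
finite T⁴; NOT [I] Thm 2, NOT `BetaPertH`, NOT the continuum limit, NOT Clay.

CITATION HEADER (tags CONTEXT ONLY).  [I] = T. Bałaban, Commun. Math. Phys. **109** (1987) 249–301 [Balaban1987RG1]: (0.20) p. 256, Thm 2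
p. 259 (first sentence), (2.12)–(2.14) p. 268.
-/

namespace Summit.QuantumFields.BalabanUV.Gaps.EndDrawdownLinearPartialRecovery

open Literature.MathematicalPhysics.QuantumFieldTheory.Balaban1983to89
open Literature.MathematicalPhysics.QuantumFieldTheory.Balaban1983to89.FlowStep
open Literature.MathematicalPhysics.QuantumFieldTheory.Balaban1983to89.FlowStepRuns
open Literature.MathematicalPhysics.QuantumFieldTheory.Balaban1983to89.DagBinding
open Summit.QuantumFields.BalabanUV.Gaps.EndDrawdownLinearRoad
open Summit.QuantumFields.BalabanUV.Gaps.EndDrawdownLinearRoadStrict (blk blk_of_mem lt_pow_of_blk_lt)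
open Summit.QuantumFields.BalabanUV.Gaps.EndDrawdownCooperatorExtremal
open Summit.QuantumFields.BalabanUV.Gaps.EndDrawdownLinearRecovering
open Summit.QuantumFields.BalabanUV.Gaps.EndDrawdownLinearCeiling
open Finset

noncomputable section

/-! ## §1 The staircase with partial recovery -/

section Part

variable {κ θ : ℝ}

/-- THE STAIRCASE WITH PARTIAL RECOVERY · `bPart κ θ j := −κ∕2^{blk j}` except at the last index of each block, where it recovers the fraction `θ`
of the block: `θ·(15·16^{blk j} − 1)·κ∕2^{blk j}` (`bPart κ 1 = bRec κ`). A TOY. [folklore] -/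
def bPart (κ θ : ℝ) (j : ℕ) : ℝ :=
  if j + 2 = 16 ^ (blk j + 1) then θ * (κ / 2 ^ blk j * (15 * 16 ^ blk j - 1)) else -(κ / 2 ^ blk j)

/-- Full recovery is the recovering staircase. [folklore] -/
theorem bPart_one (κ : ℝ) : bPart κ 1 = bRec κ := by
  funext j; unfold bPart bRec; split_ifs <;> ring

/-- More recovery only raises the sequence: `bRec κ ≤ bPart κ θ` pointwise for `θ ≥ 1`, `κ ≥ 0`. [folklore] -/
theorem bRec_le_bPart (hκ : 0 ≤ κ) (hθ : 1 ≤ θ) (j : ℕ) : bRec κ j ≤ bPart κ θ j := by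
  unfold bPart bRec
  split_ifs with h
  · have h1 : (0 : ℝ) ≤ κ / 2 ^ blk j * (15 * 16 ^ blk j - 1) :=
      mul_nonneg (by positivity) (by linarith [one_le_pow₀ (show (1 : ℝ) ≤ 16 by norm_num) (n := blk j)])
    nlinarith
  · exact le_rfl

/-- On a rate index of block `t` (`blockStart t ≤ j`, `j + 1 < blockStart (t+1)`): `bPart κ θ j = −κ∕2^t`. [folklore] -/
theorem bPart_rate {t j : ℕ} (h1 : blockStart t ≤ j) (h2 : j + 1 < blockStart (t + 1)) : bPart κ θ j = -(κ / 2 ^ t) := by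
  have hs := blockStart_add_one t; have hs' := blockStart_add_one (t + 1)
  have hblk : blk j = t := blk_of_mem (by omega) (by omega)
  unfold bPart; rw [if_neg (by rw [hblk]; omega), hblk]

/-- At the joint of block `t` (`j + 1 = blockStart (t+1)`): `bPart κ θ j = θ·(15·16^t − 1)κ∕2^t`. [folklore] -/
theorem bPart_joint {t j : ℕ} (hj : j + 1 = blockStart (t + 1)) : bPart κ θ j = θ * (κ / 2 ^ t * (15 * 16 ^ t - 1)) := by
  have hs := blockStart_add_one t; have hs' := blockStart_add_one (t + 1)
  have hp : 16 ^ (t + 1) = 16 * 16 ^ t := by rw [pow_succ, mul_comm]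
  have h16 : 1 ≤ 16 ^ t := Nat.one_le_pow _ _ (by norm_num)
  have hblk : blk j = t := blk_of_mem (by omega) (by omega)
  unfold bPart; rw [if_pos (by rw [hblk]; omega), hblk]

end Part

/-! ## §2 The parametrised ceiling and the descending staircase with joints -/

section Joint

variable {b : ℕ → ℝ} {C γ : ℝ} {K : ℕ} {z : ℕ → ℝ}
variable (hγ : 0 < γ) (hC : 0 < C) (hz : ∀ i, i < K → stepMap b (fun x => C * x) γ i (z i) = z (i + 1))
include hγ hC hz

/-- Over a run of rate steps `[k, k')` (`b ≤ −ε`, all above the clamp): `z_k ≤ max(m²(C∕ε)², z_{k'} − (k' − k)(1 − 1∕m)ε)`. [folklore] -/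
theorem backOrbit_block_ceiling_m {m : ℝ} (hm : 1 ≤ m) {k k' : ℕ} (hkk' : k ≤ k') (hk' : k' ≤ K) {ε : ℝ} (hε : 0 < ε)
    (hb : ∀ j, k ≤ j → j < k' → b j ≤ -ε) (hA : ∀ j, j ≤ K → 1 / γ ^ 2 ≤ z j) :
    z k ≤ max (m ^ 2 * (C / ε) ^ 2) (z k' - ((k' - k : ℕ) : ℝ) * ((1 - 1 / m) * ε)) := by
  suffices h : ∀ d j, j + d = k' → k ≤ j → z j ≤ max (m ^ 2 * (C / ε) ^ 2) (z k' - (d : ℝ) * ((1 - 1 / m) * ε)) by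
    have := h (k' - k) k (by omega) le_rfl
    simpa using this
  have hδ : 0 ≤ (1 - 1 / m) * ε := mul_nonneg (by rw [sub_nonneg, div_le_one (by positivity)]; exact hm) hε.le
  intro d
  induction d with
  | zero => intro j hj _; rw [show j = k' by omega]; simp
  | succ d ih =>
    intro j hj hkj
    have hjK : j < K := by omega
    have h1 := backOrbit_ceiling_lin_m hγ hC hz hm hjK hε (hb j hkj (by omega)) (hA j hjK.le)
    have h2 := ih (j + 1) (by omega) (by omega)
    rcases le_max_iff.mp h1 with h1 | h1
    · exact h1.trans (le_max_left _ _)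
    · rcases le_max_iff.mp h2 with h2 | h2
      · exact le_max_iff.mpr (Or.inl (by linarith))
      · refine le_max_iff.mpr (Or.inr ?_)
        have : ((d + 1 : ℕ) : ℝ) = (d : ℝ) + 1 := by push_cast; ring
        rw [this]; linarith

/-- **THE DESCENDING STAIRCASE WITH JOINTS PINS THE ORBIT BELOW THE CLAMP** · blocks `[i_s, i_{s+1})`, `s < T`, each = rate steps `b ≤ −ε_s` followed
by ONE joint step `b ≤ P_s` (last index); the orbit ends at the last block's joint `K = i_T − 1` (so the last block contributes rate steps only);
with `m ≥ 1`, help bound `Cγ ≤ G`, chain `m²(C∕ε_{s+1})² − m²(C∕ε_s)² + P_s + G ≤ n_s(1 − 1∕m)ε_s` (`n_s = i_{s+1} − 1 − i_s` rate steps), last block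
`z_K − m²(C∕ε_{T−1})² ≤ n_{T−1}(1 − 1∕m)ε_{T−1}` and top ceiling `m²(C∕ε_0)² < 1∕γ²`: the orbit is below the clamp somewhere on `[0, K]`. [folklore] -/
theorem backOrbit_below_clamp_of_jointStaircase {m G : ℝ} (hm : 1 ≤ m) (hG : C * γ ≤ G) {T : ℕ} (hT : 1 ≤ T) {idx : ℕ → ℕ} {ε P : ℕ → ℝ}
    (hmono : ∀ s, s < T → idx s + 1 ≤ idx (s + 1)) (hKT : idx T = K + 1) (hε : ∀ s, s < T → 0 < ε s)
    (hb : ∀ s, s < T → ∀ j, idx s ≤ j → j + 1 < idx (s + 1) → b j ≤ -ε s)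
    (hjoint : ∀ s, s + 1 < T → b (idx (s + 1) - 1) ≤ P s)
    (hchain : ∀ s, s + 1 < T → m ^ 2 * (C / ε (s + 1)) ^ 2 - m ^ 2 * (C / ε s) ^ 2 + P s + G ≤
      ((idx (s + 1) - 1 - idx s : ℕ) : ℝ) * ((1 - 1 / m) * ε s))
    (hlast : z K - m ^ 2 * (C / ε (T - 1)) ^ 2 ≤ ((idx T - 1 - idx (T - 1) : ℕ) : ℝ) * ((1 - 1 / m) * ε (T - 1)))
    (htop : m ^ 2 * (C / ε 0) ^ 2 < 1 / γ ^ 2) : ∃ i, i ≤ K ∧ z i < 1 / γ ^ 2 := by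
  by_contra hneg
  have hcon : ∀ i, i ≤ K → 1 / γ ^ 2 ≤ z i := fun i hi => not_lt.mp fun hlt => hneg ⟨i, hi, hlt⟩
  have hidx : ∀ s, s ≤ T → idx s ≤ idx T := by
    suffices h : ∀ d s, s + d = T → idx s ≤ idx T from fun s hs => h (T - s) s (by omega)
    intro d
    induction d with
    | zero => intro s hs; rw [show s = T by omega]
    | succ d ih => intro s hs; exact (by have := hmono s (by omega); omega : idx s ≤ idx (s + 1)).trans (ih (s + 1) (by omega))
  -- block starts pinned under the ceilings
  have hpin : ∀ d s, s + d + 1 = T → z (idx s) ≤ m ^ 2 * (C / ε s) ^ 2 := by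
    intro d
    induction d with
    | zero =>
      intro s hs
      have hsT : s = T - 1 := by omega
      subst hsT
      have hm1 := hmono (T - 1) (by omega)
      rw [show T - 1 + 1 = T by omega] at hm1
      have h := backOrbit_block_ceiling_m hγ hC hz hm (k := idx (T - 1)) (k' := K) (by omega) le_rfl (hε (T - 1) (by omega))
        (fun j hj1 hj2 => hb (T - 1) (by omega) j hj1 (by rw [show T - 1 + 1 = T by omega]; omega)) hcon
      rw [show K - idx (T - 1) = idx T - 1 - idx (T - 1) by omega] at h
      rcases le_max_iff.mp h with h | h
      · exact h
      · linarith
    | succ d ih =>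
      intro s hs
      have hs1 : s + 1 < T := by omega
      have hm1 := hmono s (by omega)
      have hI1 : idx (s + 1) ≤ K + 1 := (hidx (s + 1) hs1.le).trans_eq hKT
      have hI1' : idx (s + 1) ≤ K := by
        have := hmono (s + 1) hs1; have := hidx (s + 1 + 1) (by omega); omega
      -- the joint at `idx (s+1) - 1`, then the rate steps `[idx s, idx (s+1) - 1)`
      have hj := backOrbit_joint_le hγ hC hz (i := idx (s + 1) - 1) (by omega)
      rw [show idx (s + 1) - 1 + 1 = idx (s + 1) by omega] at hj
      have h := backOrbit_block_ceiling_m hγ hC hz hm (k := idx s) (k' := idx (s + 1) - 1) (by omega) (by omega) (hε s (by omega))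
        (fun j hj1 hj2 => hb s (by omega) j hj1 (by omega)) hcon
      have hnext := ih (s + 1) (by omega)
      have hc := hchain s hs1
      have hP := hjoint s hs1
      rcases le_max_iff.mp h with h | h
      · exact h
      · linarith
  have h0 := hpin (T - 1) 0 (by omega)
  have hA0 := hcon (idx 0) (by
    have h1 := hidx (0 + 1) hT
    have h2 := hmono 0 (by omega)
    omega)
  linarith

omit hγ hz in
/-- **THE DESCENDING STAIRCASE WITH JOINTS: OBSTRUCTION AT END GRADE** · if for every depth `D` the sequence `b` contains such a staircase (parameter
`m ≥ 1`, help budget `G > 0`, top rate `≥ ε̄ > 0`, last block's rate steps of `(1−1∕m)`-depth `≥ D`), then NO forward-generated construction of the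
linear cooperator `b_k + C g_k` has E — hence `¬ EndPossibleLin b C γ₀` on every box (extremality). [cite: Balaban1987RG1, Thm 2 p.259 (first sentence) and (2.12)–(2.14) p.268] -/
theorem not_endPossibleLin_of_jointStaircase {m G εbar : ℝ} (hm : 1 ≤ m) (hG : 0 < G) (hεbar : 0 < εbar)
    (h : ∀ D : ℝ, ∃ (T : ℕ) (idx : ℕ → ℕ) (ε P : ℕ → ℝ), 1 ≤ T ∧ (∀ s, s < T → idx s + 1 ≤ idx (s + 1)) ∧ (∀ s, s < T → 0 < ε s) ∧
      εbar ≤ ε 0 ∧ (∀ s, s < T → ∀ j, idx s ≤ j → j + 1 < idx (s + 1) → b j ≤ -ε s) ∧ (∀ s, s + 1 < T → b (idx (s + 1) - 1) ≤ P s) ∧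
      (∀ s, s + 1 < T → m ^ 2 * (C / ε (s + 1)) ^ 2 - m ^ 2 * (C / ε s) ^ 2 + P s + G ≤
        ((idx (s + 1) - 1 - idx s : ℕ) : ℝ) * ((1 - 1 / m) * ε s)) ∧
      D ≤ ((idx T - 1 - idx (T - 1) : ℕ) : ℝ) * ((1 - 1 / m) * ε (T - 1)))
    {γ₀ : ℝ} (hγ₀ : 0 < γ₀) : ¬ EndPossibleLin b C γ₀ := by
  intro hP
  have hE := (endPossibleLin_iff_modelOf hC.le hγ₀).mp hP
  obtain ⟨γ₂, hγ₂, hγ⟩ := hE 0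
  set γ : ℝ := min γ₂ (min (εbar / (2 * m * C)) (G / C)) with hγdef
  have hγpos : 0 < γ := lt_min hγ₂ (lt_min (by positivity) (by positivity))
  have hγtop : γ ≤ εbar / (2 * m * C) := (min_le_right _ _).trans (min_le_left _ _)
  have hγG : C * γ ≤ G := by
    have : γ ≤ G / C := (min_le_right _ _).trans (min_le_right _ _)
    rwa [le_div_iff₀ hC, mul_comm] at this
  obtain ⟨gstar, hgstar, hg⟩ := hγ γ hγpos (min_le_left _ _)
  obtain ⟨T, idx, ε, P, hT, hmono, hε, hε0, hb, hjoint, hchain, hlast⟩ := h (1 / gstar ^ 2)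
  have hm0 := hmono (T - 1) (by omega)
  rw [show T - 1 + 1 = T by omega] at hm0
  have hKT : idx T = (idx T - 1) + 1 := by omega
  obtain ⟨g0, hI, hKend⟩ := hg gstar hgstar le_rfl (idx T - 1)
  obtain ⟨z, hzK, hz⟩ := exists_backOrbit (b := b) (H := fun x => C * x) hγpos (continuousOn_linHelp C γ)
    (monotoneOn_linHelp hC.le γ) (idx T - 1) (1 / gstar ^ 2)
  have hdom := backOrbit_ge_traj hγpos (monotoneOn_linHelp hC.le γ) hI
    (steps_dominated_of_coopRun (H := fun x => C * x) (fun k _ hp => betaLin_of_pos b C k hp) (modelOf_forwardGenerated _)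
      ⟨idx T - 1, 0, g0⟩ hI) (by rw [hzK]; exact le_of_eq (by rw [hKend])) hz
  have hall : ∀ i, i ≤ idx T - 1 → 1 / γ ^ 2 ≤ z i := fun i hi =>
    (one_div_le_one_div_of_le (pow_pos (hI i hi).1 2) (pow_le_pow_left₀ (hI i hi).1.le (hI i hi).2 2)).trans (hdom i hi)
  have htop : m ^ 2 * (C / ε 0) ^ 2 < 1 / γ ^ 2 := by
    have h1 : m ^ 2 * (C / ε 0) ^ 2 ≤ (m * C / εbar) ^ 2 := by
      rw [show (m * C / εbar) ^ 2 = m ^ 2 * (C / εbar) ^ 2 by ring]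
      have := div_le_div_of_nonneg_left hC.le hεbar hε0
      have h0 : 0 ≤ C / ε 0 := div_nonneg hC.le (hεbar.le.trans hε0)
      nlinarith [pow_le_pow_left₀ h0 this 2, sq_nonneg m]
    have h3 : 2 * (m * C / εbar) ≤ 1 / γ := by
      rw [le_div_iff₀ hγpos]
      have := (le_div_iff₀ (by positivity : (0 : ℝ) < 2 * m * C)).mp hγtop
      have e : 2 * (m * C / εbar) * γ = γ * (2 * m * C) / εbar := by ring
      rw [e, div_le_one hεbar]; exact this
    have hq : 0 < m * C / εbar := by positivity
    have e1 : (1 / γ) ^ 2 = 1 / γ ^ 2 := by ring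
    nlinarith [pow_le_pow_left₀ (by positivity) h3 2]
  have hlast' : z (idx T - 1) - m ^ 2 * (C / ε (T - 1)) ^ 2 ≤ ((idx T - 1 - idx (T - 1) : ℕ) : ℝ) * ((1 - 1 / m) * ε (T - 1)) := by
    rw [hzK]
    have : 0 ≤ m ^ 2 * (C / ε (T - 1)) ^ 2 := by positivity
    linarith
  obtain ⟨i, hi, hlt⟩ := backOrbit_below_clamp_of_jointStaircase hγpos hC hz hm hγG hT hmono hKT hε hb hjoint hchain hlast' htop
  exact absurd (hall i hi) (not_le.mpr hlt)

end Joint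

/-! ## §3 The dichotomy: partial recovery `θ < 1` is impossible for every `C`; `θ ≥ 1` possible for every `C` -/

section Dichotomy

variable {κ θ C : ℝ}

/-- **PARTIAL RECOVERY IS IMPOSSIBLE ON EVERY LINEAR ROAD** (`κ > 0`, `0 ≤ θ < 1`, `C > 0`, every box): with `m = 2∕(1−θ)` each block of `bPart κ θ`
still descends by `((1−θ)∕2)(15·16^t − 1)κ∕2^t ≥ 7(1−θ)κ·8^t` read backward, against ceiling gaps `12C²4^t∕((1−θ)²κ²)` — the descending
staircase with joints from block `t₀(θ, κ, C)` on. [cite: Balaban1987RG1, Thm 2 p.259 (first sentence) and (2.12)–(2.14) p.268] -/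
theorem not_endPossibleLin_bPart (hκ : 0 < κ) (hθ0 : 0 ≤ θ) (hθ : θ < 1) (hC : 0 < C) {γ₀ : ℝ} (hγ₀ : 0 < γ₀) :
    ¬ EndPossibleLin (bPart κ θ) C γ₀ := by
  have h1θ : 0 < 1 - θ := by linarith
  set m : ℝ := 2 / (1 - θ) with hm
  have hm1 : 1 ≤ m := by rw [hm, le_div_iff₀ h1θ]; linarith
  have hrate : (1 - 1 / m) = (1 + θ) / 2 := by rw [hm]; field_simp; ring
  -- the first good block
  obtain ⟨t₀, ht₀⟩ : ∃ t₀ : ℕ, 12 * C ^ 2 / ((1 - θ) ^ 2 * κ ^ 2) + 1 ≤ 7 * (1 - θ) * κ * 2 ^ t₀ := by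
    obtain ⟨n, hn⟩ := pow_unbounded_of_one_lt ((12 * C ^ 2 / ((1 - θ) ^ 2 * κ ^ 2) + 1) / (7 * (1 - θ) * κ)) (by norm_num : (1 : ℝ) < 2)
    exact ⟨n, by rw [div_lt_iff₀ (by positivity)] at hn; linarith⟩
  refine not_endPossibleLin_of_jointStaircase hC hm1 one_pos (show (0 : ℝ) < κ / 2 ^ t₀ by positivity) (fun D => ?_) hγ₀
  obtain ⟨T₀, hT₀⟩ := pow_unbounded_of_one_lt (D / (7 * κ * 8 ^ t₀)) (by norm_num : (1 : ℝ) < 8)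
  -- geometry of the position blocks
  have hgeo : ∀ t : ℕ, ((blockStart (t + 1) - 1 - blockStart t : ℕ) : ℝ) = 15 * 16 ^ t - 1 := fun t => by
    have hs := blockStart_add_one t; have hs' := blockStart_add_one (t + 1)
    have hp : 16 ^ (t + 1) = 16 * 16 ^ t := by rw [pow_succ, mul_comm]
    have h16 : 1 ≤ 16 ^ t := Nat.one_le_pow _ _ (by norm_num)
    have h2 : blockStart (t + 1) - 1 - blockStart t + 1 = 15 * 16 ^ t := by omega
    have h3 : ((blockStart (t + 1) - 1 - blockStart t + 1 : ℕ) : ℝ) = ((15 * 16 ^ t : ℕ) : ℝ) := by exact_mod_cast h2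
    push_cast at h3; linarith
  have hdepth : ∀ t : ℕ, 7 * κ * 8 ^ t ≤ (15 * 16 ^ t - 1) * ((1 - 1 / m) * (κ / 2 ^ t)) ∧
      (15 * 16 ^ t - 1) * ((1 - 1 / m) * (κ / 2 ^ t)) - θ * (κ / 2 ^ t * (15 * 16 ^ t - 1)) ≥ 7 * (1 - θ) * κ * 8 ^ t := fun t => by
    rw [hrate]
    have e16 : (16 : ℝ) ^ t = 2 ^ t * 8 ^ t := by rw [← mul_pow]; norm_num
    have h2t : (1 : ℝ) ≤ 2 ^ t := one_le_pow₀ (by norm_num)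
    have h8t : (0 : ℝ) < 8 ^ t := by positivity
    have h18 : (1 : ℝ) ≤ 8 ^ t := one_le_pow₀ (by norm_num)
    have hsmall : (1 : ℝ) / 2 ^ t ≤ 1 := by rw [div_le_one (by positivity)]; exact h2t
    have h14 : (14 : ℝ) * 8 ^ t ≤ 15 * 8 ^ t - 1 / 2 ^ t := by linarith
    rw [e16]
    constructor
    · rw [show ((15 : ℝ) * (2 ^ t * 8 ^ t) - 1) * ((1 + θ) / 2 * (κ / 2 ^ t)) = (15 * 8 ^ t - 1 / 2 ^ t) * ((1 + θ) / 2 * κ) by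
        field_simp]
      have hB : (0 : ℝ) ≤ (1 + θ) / 2 * κ := by positivity
      have h1 := mul_le_mul_of_nonneg_right h14 hB
      have h2 : (14 : ℝ) * 8 ^ t * ((1 + θ) / 2 * κ) ≥ 7 * κ * 8 ^ t := by nlinarith [mul_nonneg hθ0 hκ.le, h8t]
      linarith
    · rw [show ((15 : ℝ) * (2 ^ t * 8 ^ t) - 1) * ((1 + θ) / 2 * (κ / 2 ^ t)) - θ * (κ / 2 ^ t * (15 * (2 ^ t * 8 ^ t) - 1))
          = (15 * 8 ^ t - 1 / 2 ^ t) * ((1 - θ) / 2 * κ) by field_simp; ring]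
      have hB : (0 : ℝ) ≤ (1 - θ) / 2 * κ := by positivity
      have h1 := mul_le_mul_of_nonneg_right h14 hB
      have e : (14 : ℝ) * 8 ^ t * ((1 - θ) / 2 * κ) = 7 * (1 - θ) * κ * 8 ^ t := by ring
      linarith
  refine ⟨T₀ + 1, fun s => blockStart (t₀ + s), fun s => κ / 2 ^ (t₀ + s), fun s => θ * (κ / 2 ^ (t₀ + s) * (15 * 16 ^ (t₀ + s) - 1)),
    by omega, fun s _ => ?_, fun s _ => by positivity, by simp, fun s _ j hj1 hj2 => ?_, fun s _ => ?_, fun s _ => ?_, ?_⟩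
  · dsimp only
    have := blockStart_add_one (t₀ + s); have := blockStart_add_one (t₀ + s + 1)
    have : 16 ^ (t₀ + s + 1) = 16 * 16 ^ (t₀ + s) := by rw [pow_succ, mul_comm]
    rw [show t₀ + (s + 1) = t₀ + s + 1 by ring]; omega
  · dsimp only at hj1 hj2 ⊢
    rw [show t₀ + (s + 1) = t₀ + s + 1 by ring] at hj2
    exact le_of_eq (bPart_rate hj1 hj2)
  · dsimp only
    rw [show t₀ + (s + 1) = t₀ + s + 1 by ring]
    exact le_of_eq (bPart_joint (by have := blockStart_add_one (t₀ + s + 1); have : 1 ≤ 16 ^ (t₀ + s + 1) := Nat.one_le_pow _ _ (by norm_num); omega))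
  · -- the chain on block t = t₀ + s
    dsimp only
    set t : ℕ := t₀ + s with htdef
    rw [show t₀ + (s + 1) = t + 1 by rw [htdef]; ring, hgeo t]
    have hd := (hdepth t).2
    have e1 : m ^ 2 * (C / (κ / 2 ^ (t + 1))) ^ 2 - m ^ 2 * (C / (κ / 2 ^ t)) ^ 2 = 12 * C ^ 2 / ((1 - θ) ^ 2 * κ ^ 2) * 4 ^ t := by
      rw [hm, pow_succ, show (4 : ℝ) ^ t = (2 ^ t) ^ 2 by rw [← pow_mul, mul_comm, pow_mul]; norm_num]
      field_simp; ring
    rw [e1]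
    have h4 : (1 : ℝ) ≤ 4 ^ t := one_le_pow₀ (by norm_num)
    have h2 : (2 : ℝ) ^ t₀ ≤ 2 ^ t := pow_le_pow_right₀ (by norm_num) (by omega)
    have e8 : (8 : ℝ) ^ t = 2 ^ t * 4 ^ t := by rw [← mul_pow]; norm_num
    have hq : 0 ≤ 12 * C ^ 2 / ((1 - θ) ^ 2 * κ ^ 2) := by positivity
    have s1 : 12 * C ^ 2 / ((1 - θ) ^ 2 * κ ^ 2) + 1 ≤ 7 * (1 - θ) * κ * 2 ^ t :=
      ht₀.trans (mul_le_mul_of_nonneg_left h2 (by positivity))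
    have s2 := mul_le_mul_of_nonneg_right s1 (by positivity : (0 : ℝ) ≤ 4 ^ t)
    have s3 : 12 * C ^ 2 / ((1 - θ) ^ 2 * κ ^ 2) * 4 ^ t + 1 ≤ (12 * C ^ 2 / ((1 - θ) ^ 2 * κ ^ 2) + 1) * 4 ^ t := by nlinarith
    have e9 : 7 * (1 - θ) * κ * 2 ^ t * 4 ^ t = 7 * (1 - θ) * κ * 8 ^ t := by rw [e8]; ring
    linarith
  · dsimp only
    rw [show T₀ + 1 - 1 = T₀ by omega, show t₀ + (T₀ + 1) = t₀ + T₀ + 1 by ring, hgeo (t₀ + T₀)]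
    have hd := (hdepth (t₀ + T₀)).1
    rw [div_lt_iff₀ (by positivity)] at hT₀
    have e : (8 : ℝ) ^ (t₀ + T₀) = 8 ^ t₀ * 8 ^ T₀ := pow_add _ _ _
    rw [e] at hd; nlinarith

/-- **OVER-RECOVERY IS POSSIBLE ON EVERY LINEAR ROAD** (`κ > 0`, `θ ≥ 1`, `C > 0`, every box): `bPart κ θ ≥ bRec κ` and possibility is monotone in the
one-loop part. [cite: Balaban1987RG1, Thm 2 p.259 (first sentence) and (2.12)–(2.14) p.268] -/
theorem endPossibleLin_bPart (hκ : 0 < κ) (hθ : 1 ≤ θ) (hC : 0 < C) {γ₀ : ℝ} (hγ₀ : 0 < γ₀) : EndPossibleLin (bPart κ θ) C γ₀ :=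
  endPossibleLin_mono_seq hC.le hγ₀ (bRec_le_bPart hκ.le hθ) (endPossibleLin_bRec hκ hC hγ₀)

/-- **THE DICHOTOMY: RECOVERY MUST BE COMPLETE** · for `κ > 0`, `θ ≥ 0`, `C > 0` and every box: `EndPossibleLin (bPart κ θ) C γ₀ ⟺ 1 ≤ θ` — the same
threshold for EVERY constant `C`. [cite: Balaban1987RG1, Thm 2 p.259 (first sentence) and (2.12)–(2.14) p.268] -/
theorem endPossibleLin_bPart_iff (hκ : 0 < κ) (hθ0 : 0 ≤ θ) (hC : 0 < C) {γ₀ : ℝ} (hγ₀ : 0 < γ₀) :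
    EndPossibleLin (bPart κ θ) C γ₀ ↔ 1 ≤ θ :=
  ⟨fun h => le_of_not_gt fun hlt => not_endPossibleLin_bPart hκ hθ0 hlt hC hγ₀ h, fun h => endPossibleLin_bPart hκ h hC hγ₀⟩

end Dichotomy

end

end Summit.QuantumFields.BalabanUV.Gaps.EndDrawdownLinearPartialRecovery
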